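import Summits.QuantumFields.YangMills.Theorems.UnitScaleTiltProp7CmapTwSReadSet
import Summits.QuantumFields.YangMills.Theorems.UnitScaleTiltProp7SectET3DeltaOneT3PInvGlue
import Summits.QuantumFields.YangMills.Theorems.UnitScaleTiltProp7SigmaRowsNorm
import Summits.QuantumFields.YangMills.Theorems.UnitScaleTiltProp7BlockDistanceWeights
import HarnessLib

/-!
# Route `UnitScaleTilt`, crux K1 «MinimiserStabilityRegPr» (stmt-QuantumFields-19200), EX rows `hCk` ∕ `h137kΔ` ∕ `norm_G` ∕ `norm_H₁` (J-slot) — **K-STOREY BRICK (K2b-δ₃)-F (px12 g17):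
# PRINT's J-TERM `T_Jᴾ(U₀)` IS TWO-BLOCK LOCAL, SO ITS SUP ROW IS A KERNEL ROW** — the displayed letter `hkS` of (K2b-δ₃)-E ✓∕⧗`Prop7OneFormConjugateResolventKernelSlot` for the slot
# operator `S := T_Jᴾ` from the T_J sup row of record (`hTJsup` ⟸ ✓`Prop7TJRowOfEntry157Lift.hTJ_of_hHcol_h157` ⟸ `hHcol` ∧ `hC157`): `⟪T_Jᴾ(toL2 X), toL2 X′⟫ = (2c₀∕η²)·∇S(H(avgHess Xᴴ X′))`
# (✓`inner_TJP_left`) and the averaging Hessian `avgHess = D²(log U̿^{twS})(0)` READS ONLY THE TWO BLOCKS OF EACH COARSE BOND (routeR-w4 ✓`fderiv_logChartTwS_apply_eq_zero_of_vanish_on_reads` +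
# symmetry of the second derivative of an analytic map), hence `(toL2⁻¹ T_Jᴾ toL2 (δ_b Z))(bd) = 0` unless the blocks of `b₋` and `bd₋` are adjacent, and
# **`‖(toL2⁻¹ T_Jᴾ toL2 (δ_b Z))(bd)‖ ≤ (k·e^{μ′})·e^{−μ′·tdist(B b₋, B bd₋)}·‖Z‖`** for every `μ′ ≥ 0`.

Cell `ym3-torus` (HUMAN RULING D-0037: SU(2) YM₃ on T³ is ladder rung R3 — NOT d = 4, NOT infinite volume, NOT a mass gap, NOT Clay).  Width seat `ym3-torus-px12` gen 17.  THEOREMS ONLY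
(0 `def`, 0 `sorry`, default heartbeats); `--supports stmt-QuantumFields-19200 --as helper`, count-neutral.  HONEST LABEL: calculus over routeR-w4's read-set locality and px13 g5's testing
identity; the sup row `hrow` (⟸ `hHcol`, `hC157`, DISPLAYED rows of the EX face) stays a hypothesis; nothing of (3.133)∕(3.137), `hCk`, `h137kΔ`, EX or 19200 is proved here.

WHAT IS PROVED (ns `Summit.QuantumFields.YangMills.Theorems.Prop7TJKernelLocality`; member `F`, `h : n ≤ K`, weights `c₀ cB`, coupling `a`; `RegPr F n K ε₀ U₀` + the chart windows
`10⁹L²e ≤ 1`, `10¹²L³ε₀ ≤ 1` of ✓`analyticOnNhd_logChartTwS`).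
* §1 ★ `avgHess_apply_eq_zero_of_vanish_right` (`X′ = 0` on the read set of `ĉ` ⟹ `avgHess X X′ ĉ = 0`), `avgHess_symm` (`avgHess X X′ = avgHess X′ X`, ✓`ContDiffAt.isSymmSndFDerivAt`),
  ★ `avgHess_apply_eq_zero_of_vanish_left`, ★★ `avgHess_single_single_eq_zero_of_far` (`tdist(B b₋, B bd₋) ≥ 2` ⟹ `avgHess (δ_b Z) (δ_bd A) = 0`).
* §2 ★★ `TJP_single_apply_eq_zero_of_far` (the kernel of `T_Jᴾ` vanishes off adjacent blocks), ★★★ `kernelRow_TJSlotP_of_supRow` (the `hkS` text of (K2b-δ₃)-E for `S := TJSlotP`, `C_S = k·e^{μ′}`).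
HYP-SAT (★★OWNER RULING №42): `hrow` = the `hTJsup` row of record (✓`tauRow_TJP_of_supRow`'s hypothesis VERBATIM; inhabited by ✓`hTJ_of_hHcol_h157` from the displayed `hHcol`, `hC157`); the
windows as routeR-w4; nothing eventual; no hypothesis restates the conclusion.

References: T. Bałaban, CMP **99** (1985) 389–434 [Balaban1985BackgroundPropagators] ((3.13)–(3.14) p.393, (3.127)–(3.128) p.421, (3.137) p.423); CMP **102** (1985) 277–309
[Balaban1985Variational] ((72)–(73) p.289); CMP **98** (1985) 17–51 [Balaban1985Averaging] ((110) p.34).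
-/

set_option autoImplicit false

noncomputable section

open scoped InnerProductSpace ComplexConjugate Matrix.Norms.L2Operator BigOperators Matrix

namespace Summit.QuantumFields.YangMills.Theorems.Prop7TJKernelLocality

open Literature.MathematicalPhysics.QuantumFieldTheory.Balaban1983to89
open Literature.MathematicalPhysics.QuantumFieldTheory.Balaban1983to89.T3ContinuumYM3Torus
open T3SectALandauChart (eta eta_pos)
open T3PrintedRegularMinimiser (RegPr)
open T3PrintedRegularOrbits (sites_eq)
open T3LevelShift (bondShift)
open B5Eq118OneStroke (iterBlockOf)
open B11Eq103H1Complex (SiteL2K BondL2K)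
open Summit.QuantumFields.YangMills.Theorems.Prop7SectET3Transport (periodsT3)
open Summit.QuantumFields.YangMills.Theorems.Prop7SectET3HilbertLetters (W₂ frobEquiv toL2 inner_toL2)
open Summit.QuantumFields.YangMills.Theorems.Prop7SectET3DeltaPiPInv (H46P)
open Summit.QuantumFields.YangMills.Theorems.Prop7SectET3DeltaOne (actionGrad avgHess)
open Summit.QuantumFields.YangMills.Theorems.Prop7SymAvgTwSym (logChartTwS)
open Summit.QuantumFields.YangMills.Theorems.Prop7SectET3DeltaOnePInv (TJP TJSlotP tjFormP_apply tjSesqP_apply inner_TJP_left TJSlotP_apply)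
open Summit.QuantumFields.YangMills.Theorems.Prop7CmapTwSymInputs (analyticOnNhd_logChartTwS)
open Summit.QuantumFields.YangMills.Theorems.Prop7CmapTwSReadSet (fderiv_logChartTwS_apply_eq_zero_of_vanish_on_reads)
open Summit.QuantumFields.YangMills.Theorems.Prop7SigmaRowsNorm (c0_mul_sum_norm_sq_le_norm_sq_toL2)
open Summit.QuantumFields.YangMills.Theorems.Prop7BlockDistanceWeights (tdist_src_tgt_le_one)
open B3Taylor310LocalRemainder (tdist_comm)

variable (F : T3Family) {n K : ℕ} (h : n ≤ K)

/-! ## §1 The averaging Hessian reads two blocks -/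

section Hessian

variable {ε₀ e : ℝ} (hε₀ : 0 < ε₀) (he : 0 < e) (hWe : 10 ^ 9 * (F.L : ℝ) ^ 2 * e ≤ 1) (hWε : 10 ^ 12 * (F.L : ℝ) ^ 3 * ε₀ ≤ 1)
  (U₀ : GaugeField (F.P K) 0 (Matrix.specialUnitaryGroup (Fin 2) ℂ)) (hreg : RegPr F n K ε₀ U₀)

include hε₀ he hWe hWε hreg in
/-- ★ **`avgHess X X′ ĉ = 0` WHEN `X′` VANISHES ON THE READ SET OF `ĉ`**: `avgHess = D(A ↦ D(log U̿^{twS})(A))(0)`, and `A ↦ D(log U̿^{twS})(A)X′ ĉ` vanishes identically on the analyticity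
ball (routeR-w4 ✓`fderiv_logChartTwS_apply_eq_zero_of_vanish_on_reads`), so its derivative at `0` along `X` vanishes. [cite: Balaban1985Variational, (72) p.289; Balaban1985Averaging, (110) p.34] -/
theorem avgHess_apply_eq_zero_of_vanish_right (X X' : PBond (F.P K) 0 → Matrix (Fin 2) (Fin 2) ℂ) (c : PBond (F.P n) 0)
    (hX' : ∀ b : PBond (F.P K) 0,
      (iterBlockOf (K - n) b.src = (bondShift (sites_eq F n K h) c).src ∨ iterBlockOf (K - n) b.src = (bondShift (sites_eq F n K h) c).tgt) →
      (iterBlockOf (K - n) b.tgt = (bondShift (sites_eq F n K h) c).src ∨ iterBlockOf (K - n) b.tgt = (bondShift (sites_eq F n K h) c).tgt) → X' b = 0) :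
    avgHess F n K h U₀ X X' c = 0 := by
  -- evaluation at `X′` then at `c` is a continuous linear map `Φ`
  set Φ : ((PBond (F.P K) 0 → Matrix (Fin 2) (Fin 2) ℂ) →L[ℂ] (PBond (F.P n) 0 → Matrix (Fin 2) (Fin 2) ℂ)) →L[ℂ] Matrix (Fin 2) (Fin 2) ℂ :=
    (ContinuousLinearMap.proj c : (PBond (F.P n) 0 → Matrix (Fin 2) (Fin 2) ℂ) →L[ℂ] Matrix (Fin 2) (Fin 2) ℂ).comp
      (ContinuousLinearMap.apply ℂ (PBond (F.P n) 0 → Matrix (Fin 2) (Fin 2) ℂ) X') with hΦ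
  have hΦapply : ∀ T : (PBond (F.P K) 0 → Matrix (Fin 2) (Fin 2) ℂ) →L[ℂ] (PBond (F.P n) 0 → Matrix (Fin 2) (Fin 2) ℂ), Φ T = T X' c := fun T => rfl
  have hval : avgHess F n K h U₀ X X' c = Φ (fderiv ℂ (fderiv ℂ (logChartTwS F n K h U₀)) 0 X) := by rw [hΦapply]; rfl
  rw [hval]
  -- the composed scalar map vanishes on the ball around `0`
  have hzero : (⇑Φ ∘ fderiv ℂ (logChartTwS F n K h U₀)) =ᶠ[nhds 0] fun _ => (0 : Matrix (Fin 2) (Fin 2) ℂ) := by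
    have hball : Metric.ball (0 : PBond (F.P K) 0 → Matrix (Fin 2) (Fin 2) ℂ) (e * eta F n K) ∈ nhds (0 : PBond (F.P K) 0 → Matrix (Fin 2) (Fin 2) ℂ) :=
      Metric.ball_mem_nhds _ (mul_pos he (eta_pos F n K))
    filter_upwards [hball] with A hA
    rw [Function.comp_apply, hΦapply]
    exact fderiv_logChartTwS_apply_eq_zero_of_vanish_on_reads F n K h hε₀ he hWe hWε U₀ hreg (mem_ball_zero_iff.1 hA) X' c hX'
  by_cases hd : DifferentiableAt ℂ (fderiv ℂ (logChartTwS F n K h U₀)) 0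
  · have hcomp : fderiv ℂ (⇑Φ ∘ fderiv ℂ (logChartTwS F n K h U₀)) 0 = Φ.comp (fderiv ℂ (fderiv ℂ (logChartTwS F n K h U₀)) 0) := by
      rw [fderiv_comp _ Φ.differentiableAt hd, ContinuousLinearMap.fderiv]
    have h1 : Φ (fderiv ℂ (fderiv ℂ (logChartTwS F n K h U₀)) 0 X) = fderiv ℂ (⇑Φ ∘ fderiv ℂ (logChartTwS F n K h U₀)) 0 X := by
      rw [hcomp]; rfl
    rw [h1, hzero.fderiv_eq]
    simp
  · rw [fderiv_zero_of_not_differentiableAt hd]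
    simp

include hε₀ he hWe hWε hreg in
/-- **THE AVERAGING HESSIAN IS SYMMETRIC**: `avgHess X X′ = avgHess X′ X` (the second derivative of the analytic chart at `0`; ✓`ContDiffAt.isSymmSndFDerivAt`). [cite: Balaban1985Averaging, (110) p.34] -/
theorem avgHess_symm (X X' : PBond (F.P K) 0 → Matrix (Fin 2) (Fin 2) ℂ) : avgHess F n K h U₀ X X' = avgHess F n K h U₀ X' X := by
  have han : AnalyticAt ℂ (logChartTwS F n K h U₀) 0 :=
    analyticOnNhd_logChartTwS F h hε₀ he hWe hWε U₀ hreg 0 (Metric.mem_ball_self (mul_pos he (eta_pos F n K)))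
  have hs : IsSymmSndFDerivAt ℂ (logChartTwS F n K h U₀) 0 := (han.contDiffAt (n := ⊤)).isSymmSndFDerivAt (by simp)
  rw [Prop7SectET3DeltaOne.avgHess_def]
  exact hs X X'

include hε₀ he hWe hWε hreg in
/-- ★ **`avgHess X X′ ĉ = 0` WHEN `X` VANISHES ON THE READ SET OF `ĉ`** (symmetry + the right edition). [cite: Balaban1985Variational, (72) p.289] -/
theorem avgHess_apply_eq_zero_of_vanish_left (X X' : PBond (F.P K) 0 → Matrix (Fin 2) (Fin 2) ℂ) (c : PBond (F.P n) 0)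
    (hX : ∀ b : PBond (F.P K) 0,
      (iterBlockOf (K - n) b.src = (bondShift (sites_eq F n K h) c).src ∨ iterBlockOf (K - n) b.src = (bondShift (sites_eq F n K h) c).tgt) →
      (iterBlockOf (K - n) b.tgt = (bondShift (sites_eq F n K h) c).src ∨ iterBlockOf (K - n) b.tgt = (bondShift (sites_eq F n K h) c).tgt) → X b = 0) :
    avgHess F n K h U₀ X X' c = 0 := by
  rw [avgHess_symm F h hε₀ he hWe hWε U₀ hreg X X', avgHess_apply_eq_zero_of_vanish_right F h hε₀ he hWe hWε U₀ hreg X' X c hX]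

include hε₀ he hWe hWε hreg in
/-- ★★ **THE HESSIAN OF TWO SPIKES IN NON-ADJACENT BLOCKS VANISHES**: if `tdist(B b₋, B bd₋) ≥ 2` then `avgHess (δ_b Z) (δ_bd A) = 0` — for every coarse bond `ĉ` one of the two spikes
vanishes on the read set of `ĉ` (both source blocks in `{ĉ₋, ĉ₊}` would force `tdist ≤ 1`, ✓`tdist_src_tgt_le_one`). [cite: Balaban1985BackgroundPropagators, (3.13)–(3.14) p.393] -/
theorem avgHess_single_single_eq_zero_of_far [DecidableEq (PBond (F.P K) 0)] (b bd : PBond (F.P K) 0)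
    (hfar : 2 ≤ Site.tdist (P := F.P K) (iterBlockOf (K - n) b.src) (iterBlockOf (K - n) bd.src)) (Z A : Matrix (Fin 2) (Fin 2) ℂ) :
    avgHess F n K h U₀ (Pi.single b Z) (Pi.single bd A) = 0 := by
  funext c
  rw [Pi.zero_apply]
  by_cases hbd : iterBlockOf (K - n) bd.src = (bondShift (sites_eq F n K h) c).src ∨ iterBlockOf (K - n) bd.src = (bondShift (sites_eq F n K h) c).tgt
  · -- then `b₋`'s block is NOT one of `ĉ`'s blocks, so `δ_b Z` vanishes on the read set
    have hb : ¬ (iterBlockOf (K - n) b.src = (bondShift (sites_eq F n K h) c).src ∨ iterBlockOf (K - n) b.src = (bondShift (sites_eq F n K h) c).tgt) := by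
      intro hb
      have h1 : Site.tdist (P := F.P K) (iterBlockOf (K - n) b.src) (iterBlockOf (K - n) bd.src) ≤ 1 := by
        have hc1 : Site.tdist (P := F.P K) (bondShift (sites_eq F n K h) c).src (bondShift (sites_eq F n K h) c).tgt ≤ 1 := tdist_src_tgt_le_one _
        have hc1' : Site.tdist (P := F.P K) (bondShift (sites_eq F n K h) c).tgt (bondShift (sites_eq F n K h) c).src ≤ 1 := by rw [tdist_comm]; exact hc1
        rcases hb with hb | hb <;> rcases hbd with hbd | hbd <;> rw [hb, hbd]
        · simp [Site.tdist]
        · exact hc1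
        · exact hc1'
        · simp [Site.tdist]
      omega
    refine avgHess_apply_eq_zero_of_vanish_left F h hε₀ he hWe hWε U₀ hreg _ _ c fun b' hbs _ => ?_
    by_cases hb' : b' = b
    · subst hb'; exact absurd hbs hb
    · rw [Pi.single_eq_of_ne hb']
  · refine avgHess_apply_eq_zero_of_vanish_right F h hε₀ he hWe hWε U₀ hreg _ _ c fun b' hbs _ => ?_
    by_cases hb' : b' = bd
    · subst hb'; exact absurd hbs hbd
    · rw [Pi.single_eq_of_ne hb']

end Hessian

/-! ## §2 The kernel of `T_Jᴾ` vanishes off adjacent blocks; the kernel row from the sup row -/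

section Kernel

variable (c₀ cB : ℝ) [Fact (0 < c₀)] [Fact (0 < cB)] (a : ℝ)
  {ε₀ e : ℝ} (hε₀ : 0 < ε₀) (he : 0 < e) (hWe : 10 ^ 9 * (F.L : ℝ) ^ 2 * e ≤ 1) (hWε : 10 ^ 12 * (F.L : ℝ) ^ 3 * ε₀ ≤ 1)
  (U₀ : GaugeField (F.P K) 0 (Matrix.specialUnitaryGroup (Fin 2) ℂ)) (hreg : RegPr F n K ε₀ U₀)

include hε₀ he hWe hWε hreg in
/-- ★★ **THE KERNEL OF PRINT's J-TERM VANISHES OFF ADJACENT BLOCKS**: if `tdist(B b₋, B bd₋) ≥ 2` then `(toL2⁻¹ T_Jᴾ(U₀) toL2 (δ_b Z))(bd) = 0` — px13 g5's testing identity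
`⟪T_Jᴾ toL2 X, toL2(δ_bd·A)⟫ = (2c₀∕η²)·∇S(H(avgHess Xᴴ (δ_bd·A)))` (✓`inner_TJP_left`) at `A := ` the entry, with `avgHess (δ_b Zᴴ) (δ_bd A) = 0` (§1) and `c₀‖A‖² ≤ ‖toL2(δ_bd·A)‖²`.
[cite: Balaban1985BackgroundPropagators, (3.127)–(3.128) p.421, (3.11) p.392] -/
theorem TJP_single_apply_eq_zero_of_far [DecidableEq (PBond (F.P K) 0)] (b bd : PBond (F.P K) 0)
    (hfar : 2 ≤ Site.tdist (P := F.P K) (iterBlockOf (K - n) b.src) (iterBlockOf (K - n) bd.src)) (Z : Matrix (Fin 2) (Fin 2) ℂ) :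
    (toL2 F K c₀).symm (TJP F n K h c₀ cB a U₀ (toL2 F K c₀ (Pi.single b Z))) bd = 0 := by
  have hc₀ : (0 : ℝ) < c₀ := Fact.out
  set X : PBond (F.P K) 0 → Matrix (Fin 2) (Fin 2) ℂ := Pi.single b Z with hXdef
  set Y : PBond (F.P K) 0 → Matrix (Fin 2) (Fin 2) ℂ := (toL2 F K c₀).symm (TJP F n K h c₀ cB a U₀ (toL2 F K c₀ X)) with hYdef
  set A : Matrix (Fin 2) (Fin 2) ℂ := Y bd with hAdef
  set w : BondL2K ℂ 3 (periodsT3 F K) c₀ W₂ := toL2 F K c₀ (Pi.single bd A) with hwdef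
  have h1 : ⟪toL2 F K c₀ Y, w⟫_ℂ = ⟪w, w⟫_ℂ := by
    rw [hwdef, inner_toL2, inner_toL2]
    refine congrArg (fun z : ℂ => (c₀ : ℂ) * z) (Finset.sum_congr rfl fun b' _ => ?_)
    by_cases hb : b' = bd
    · subst hb; rw [Pi.single_eq_same]
    · rw [Pi.single_eq_of_ne hb, Matrix.mul_zero, Matrix.conjTranspose_zero, Matrix.zero_mul]
  have h2 : toL2 F K c₀ Y = TJP F n K h c₀ cB a U₀ (toL2 F K c₀ X) := by rw [hYdef, LinearEquiv.apply_symm_apply]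
  have hstar : star X = Pi.single b (star Z) := by rw [hXdef, Pi.single_star]
  have hH : avgHess F n K h U₀ (star X) (Pi.single bd A) = 0 := by
    rw [hstar]; exact avgHess_single_single_eq_zero_of_far F h hε₀ he hWe hWε U₀ hreg b bd hfar (star Z) A
  have h3 : ⟪toL2 F K c₀ Y, w⟫_ℂ = 0 := by
    rw [h2, inner_TJP_left, tjSesqP_apply, tjFormP_apply, hwdef, LinearEquiv.symm_apply_apply, LinearEquiv.symm_apply_apply, hH, map_zero, map_zero,
      neg_zero, mul_zero]
  have h5 : c₀ * ‖A‖ ^ 2 ≤ ‖w‖ ^ 2 := by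
    have hc := c0_mul_sum_norm_sq_le_norm_sq_toL2 F K c₀ (Pi.single bd A)
    rw [Finset.sum_eq_single bd (fun b' _ hb => by rw [Pi.single_eq_of_ne hb, norm_zero, zero_pow two_ne_zero])
      (fun hbd => (hbd (Finset.mem_univ bd)).elim), Pi.single_eq_same] at hc
    rwa [hwdef]
  have h6 : ‖w‖ ^ 2 = 0 := by
    have e : (‖w‖ ^ 2 : ℝ) = ‖⟪toL2 F K c₀ Y, w⟫_ℂ‖ := by
      rw [h1, inner_self_eq_norm_sq_to_K, norm_pow, RCLike.norm_ofReal, abs_norm]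
    rw [e, h3, norm_zero]
  have hA2 : ‖A‖ ^ 2 = 0 := by
    have h7 : c₀ * ‖A‖ ^ 2 ≤ 0 := h5.trans h6.le
    have h8 : 0 ≤ ‖A‖ ^ 2 := sq_nonneg _
    have h9 : ‖A‖ ^ 2 ≤ 0 := le_of_mul_le_mul_left (by rw [mul_zero]; exact h7) hc₀
    exact le_antisymm h9 h8
  exact norm_eq_zero.mp (pow_eq_zero_iff two_ne_zero |>.mp hA2)

include hε₀ he hWe hWε hreg in
/-- ★★★ **THE KERNEL ROW OF `T_Jᴾ` FROM ITS SUP ROW** (the `hkS` letter of (K2b-δ₃)-E ✓∕⧗`Prop7OneFormConjugateResolventKernelSlot.conj_resolvent_oneForm_phaseClass_slot` for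
`S := TJSlotP`): from the sup row of record `hrow` (`‖(toL2⁻¹ T_Jᴾ toL2 X)(bd)‖ ≤ k·sup‖X‖`, ✓`tauRow_TJP_of_supRow`'s hypothesis; ⟸ `hHcol` ∧ `hC157` by ✓`hTJ_of_hHcol_h157`) and any rate
`μ′ ≥ 0`: **`‖(toL2⁻¹(TJSlotP U₀ (toL2 (δ_b Z))))(bd)‖ ≤ (k·e^{μ′})·e^{−μ′·tdist(B b₋, B bd₋)}·‖Z‖`** (near pairs: the sup row and `tdist ≤ 1`; far pairs: `0`).
[cite: Balaban1985BackgroundPropagators, (3.127)–(3.128) p.421, (3.137) p.423] -/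
theorem kernelRow_TJSlotP_of_supRow [DecidableEq (PBond (F.P K) 0)] {k μ' : ℝ} (hk : 0 ≤ k) (hμ' : 0 ≤ μ')
    (hrow : ∀ (X : PBond (F.P K) 0 → Matrix (Fin 2) (Fin 2) ℂ) (s : ℝ), (∀ bd, ‖X bd‖ ≤ s) →
      ∀ bd : PBond (F.P K) 0, ‖(toL2 F K c₀).symm (TJSlotP F n K h c₀ cB a U₀ (toL2 F K c₀ X)) bd‖ ≤ k * s) :
    ∀ (b : PBond (F.P K) 0) (Z : Matrix (Fin 2) (Fin 2) ℂ) (bd : PBond (F.P K) 0),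
      ‖(toL2 F K c₀).symm (TJSlotP F n K h c₀ cB a U₀ (toL2 F K c₀ (Pi.single b Z))) bd‖
        ≤ (k * Real.exp μ') * Real.exp (-(μ' * (Site.tdist (P := F.P K) (iterBlockOf (K - n) b.src) (iterBlockOf (K - n) bd.src) : ℝ))) * ‖Z‖ := by
  intro b Z bd
  by_cases hfar : 2 ≤ Site.tdist (P := F.P K) (iterBlockOf (K - n) b.src) (iterBlockOf (K - n) bd.src)
  · rw [TJSlotP_apply, TJP_single_apply_eq_zero_of_far F h c₀ cB a hε₀ he hWe hWε U₀ hreg b bd hfar Z, norm_zero]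
    positivity
  · have hnear : (Site.tdist (P := F.P K) (iterBlockOf (K - n) b.src) (iterBlockOf (K - n) bd.src) : ℝ) ≤ 1 := by
      have : Site.tdist (P := F.P K) (iterBlockOf (K - n) b.src) (iterBlockOf (K - n) bd.src) ≤ 1 := by omega
      exact_mod_cast this
    have hsup : ∀ b', ‖(Pi.single b Z : PBond (F.P K) 0 → Matrix (Fin 2) (Fin 2) ℂ) b'‖ ≤ ‖Z‖ := fun b' => by
      by_cases hb : b' = b
      · subst hb; rw [Pi.single_eq_same]
      · rw [Pi.single_eq_of_ne hb, norm_zero]; exact norm_nonneg _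
    have h1 := hrow (Pi.single b Z) ‖Z‖ hsup bd
    have h2 : (1 : ℝ) ≤ Real.exp μ' * Real.exp (-(μ' * (Site.tdist (P := F.P K) (iterBlockOf (K - n) b.src) (iterBlockOf (K - n) bd.src) : ℝ))) := by
      rw [← Real.exp_add]
      exact Real.one_le_exp (by nlinarith)
    calc ‖(toL2 F K c₀).symm (TJSlotP F n K h c₀ cB a U₀ (toL2 F K c₀ (Pi.single b Z))) bd‖ ≤ k * ‖Z‖ := h1
      _ = k * 1 * ‖Z‖ := by ring
      _ ≤ k * (Real.exp μ' * Real.exp (-(μ' * (Site.tdist (P := F.P K) (iterBlockOf (K - n) b.src) (iterBlockOf (K - n) bd.src) : ℝ)))) * ‖Z‖ := by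
          gcongr
      _ = (k * Real.exp μ') * Real.exp (-(μ' * (Site.tdist (P := F.P K) (iterBlockOf (K - n) b.src) (iterBlockOf (K - n) bd.src) : ℝ))) * ‖Z‖ := by ring

end Kernel

end Summit.QuantumFields.YangMills.Theorems.Prop7TJKernelLocality

end
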